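import Literature.Computability.QuantumComplexity.SpectralAdversary

/-!
# Ambainis's weighted relational adversary method for `QQueryAlg`, I: one query, and the progress of a relation

Support for the crux `WhiteBoxWalk.WbwVerifiableLineNoSpeedup` (stmt-QuantumAdvantage-2239): the
generic theorem its proof route needs (refuter work file
`Cruxes/WbwVerifiableLineNoSpeedup/Disproof.lean` §7, target `WeightedAdversaryBound`). This file
and its sequel `WeightedAdversaryBound.lean` prove **Ambainis's Theorem 6** [Ambainis2000]
("Let `R ⊂ X × Y` … every `x ∈ X` has at least `m` partners, every `y ∈ Y` at least `m'`; let
`l_{x,i}` (`l_{y,i}`) be the number of partners of `x` (`y`) differing from it at `i`, and `l_max`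
the maximum of `l_{x,i} l_{y,i}` over related pairs differing at `i`. Then any quantum algorithm
computing `f` uses `Ω(√(m m'/l_max))` queries") for the tree's query model `QQueryAlg`
(`Literature/Computability/Cryptography/QuantumQuery.lean`) and PROMISE problems, with the explicit
constant `√(m m'/l_max) ≤ 144 · Q_{1/3}` coming from the gap lemma `rinner_le_of_gap` of the
tree's `SpectralAdversary.lean` (which treats only the sensitivity-graph special case for total
functions; we reuse its vector toolkit `nsq`, `rinner`, `fiberWeight`, `sum_bool_xor`, …).

The proof is Ambainis's / Høyer–Špalek's progress-function argument [HoyerSpalek2005, §4]: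
`W(Ψ) = ∑_{(x,y) ∈ R} Re⟨ψ_x|ψ_y⟩` starts at `|R|`, ends `≤ (1 - 1/72)|R|`, and one query changes
it by at most `√ℓ (λ |X| + |Y|/λ)` for every `λ > 0` (this file: `prog_sub_prog_step_le`, via the
two-oracle fibre decomposition `rinner_sub_oracle_le` and the weighted AM–GM
`2uv ≤ p u² + v²/p` with `p = λ √ℓ / l_{x,i}`, regrouped by left and right ends).
Sorry-free. Generic in nature — a librarian may relocate both files under
`Literature/Computability/QuantumComplexity/`.
-/

noncomputable section

set_option linter.dupNamespace false

namespace Summit.QuantumAdvantage.QuantumAdvantage.Theorems.WbwVerifiableLineNoSpeedup.Negative.WeightedAdversary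

open Matrix Finset Literature.Computability.Cryptography Literature.Computability.QuantumComplexity
  Literature.Computability.QuantumComplexity.SpectralAdversary

variable {N : ℕ}

/-! ### One query, two arbitrary oracles -/

section Oracle

variable {W : Type*} [Fintype W] [DecidableEq W]

/-- The fibre-`i` part of `Re ⟨a|b⟩` with the target bits shifted by `c` and `d`. [cite: Ambainis2000, Thm. 6 (proof)] -/
def fib (a b : Fin N × Bool × W → ℂ) (i : Fin N) (c d : Bool) : ℝ :=
  ∑ bb : Bool, ∑ z : W, ((starRingEnd ℂ) (a (i, (bb ^^ c), z)) * b (i, (bb ^^ d), z)).re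

omit [DecidableEq W] in
/-- `Re⟨a|b⟩` as the sum of its fibre parts. [folklore] -/
theorem rinner_eq_sum_fib (a b : Fin N × Bool × W → ℂ) :
    rinner a b = ∑ i, fib a b i false false := by
  unfold rinner fib
  rw [Fintype.sum_prod_type]
  refine Finset.sum_congr rfl fun i _ => ?_
  rw [Fintype.sum_prod_type]
  simp

/-- `Re⟨O_x a|O_y b⟩` fibre by fibre: the bit-flip oracles shift the target bits by `x i`, `y i`. [folklore] -/
theorem rinner_oracle_eq_sum_fib (x y : Fin N → Bool) (a b : Fin N × Bool × W → ℂ) :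
    rinner (queryOracle x *ᵥ a) (queryOracle y *ᵥ b) = ∑ i, fib a b i (x i) (y i) := by
  unfold rinner fib
  simp only [queryOracle_mulVec_apply]
  rw [Fintype.sum_prod_type]
  refine Finset.sum_congr rfl fun i _ => ?_
  rw [Fintype.sum_prod_type]

omit [DecidableEq W] in
/-- On a fibre where the oracles agree the shifted part equals the unshifted one. [folklore] -/
theorem fib_eq_of_eq (a b : Fin N × Bool × W → ℂ) (i : Fin N) (c : Bool) :
    fib a b i c c = fib a b i false false := by
  unfold fib
  simp only [Bool.xor_false]
  exact sum_bool_xor c fun bb => ∑ z : W, ((starRingEnd ℂ) (a (i, bb, z)) * b (i, bb, z)).re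

/-- `2uv ≤ p u² + v²/p` for `p > 0`. [cite: Ambainis2000, Thm. 6 (proof)] -/
theorem two_mul_le_weighted {p : ℝ} (hp : 0 < p) (u v : ℝ) : 2 * (u * v) ≤ p * u ^ 2 + v ^ 2 / p := by
  have h : 0 ≤ (p * u - v) ^ 2 / p := div_nonneg (sq_nonneg _) hp.le
  have e : (p * u - v) ^ 2 / p = p * u ^ 2 + v ^ 2 / p - 2 * (u * v) := by
    field_simp
    ring
  linarith

omit [DecidableEq W] in
/-- A fibre part is at most the weighted query weights: `|fib| ≤ (p β_a² + β_b²/p)/2`. [cite: Ambainis2000, Thm. 6 (proof)] -/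
theorem abs_fib_le (a b : Fin N × Bool × W → ℂ) (i : Fin N) (c d : Bool) {p : ℝ} (hp : 0 < p) :
    |fib a b i c d| ≤ (p * fiberWeight a i + fiberWeight b i / p) / 2 := by
  have h : |fib a b i c d| ≤ ∑ bb : Bool, ∑ z : W, ‖a (i, (bb ^^ c), z)‖ * ‖b (i, (bb ^^ d), z)‖ := by
    unfold fib
    refine (Finset.abs_sum_le_sum_abs _ _).trans (Finset.sum_le_sum fun bb _ => ?_)
    exact (Finset.abs_sum_le_sum_abs _ _).trans (Finset.sum_le_sum fun z _ => abs_re_conj_mul_le _ _)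
  have ha : ∑ bb : Bool, ∑ z : W, ‖a (i, (bb ^^ c), z)‖ ^ 2 = fiberWeight a i :=
    sum_bool_xor c fun bb => ∑ z : W, ‖a (i, bb, z)‖ ^ 2
  have hb : ∑ bb : Bool, ∑ z : W, ‖b (i, (bb ^^ d), z)‖ ^ 2 = fiberWeight b i :=
    sum_bool_xor d fun bb => ∑ z : W, ‖b (i, bb, z)‖ ^ 2
  calc |fib a b i c d| ≤ ∑ bb : Bool, ∑ z : W, ‖a (i, (bb ^^ c), z)‖ * ‖b (i, (bb ^^ d), z)‖ := h
    _ ≤ ∑ bb : Bool, ∑ z : W, (p * ‖a (i, (bb ^^ c), z)‖ ^ 2 + ‖b (i, (bb ^^ d), z)‖ ^ 2 / p) / 2 :=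
        Finset.sum_le_sum fun bb _ => Finset.sum_le_sum fun z _ => by
          linarith [two_mul_le_weighted hp ‖a (i, (bb ^^ c), z)‖ ‖b (i, (bb ^^ d), z)‖]
    _ = (p * fiberWeight a i + fiberWeight b i / p) / 2 := by
        rw [← ha, ← hb, Finset.mul_sum, Finset.sum_div, ← Finset.sum_add_distrib, Finset.sum_div]
        refine Finset.sum_congr rfl fun bb _ => ?_
        rw [Finset.mul_sum, Finset.sum_div, ← Finset.sum_add_distrib, Finset.sum_div]

/-- **One query, two oracles**: the inner product changes only through the fibres where the
oracles differ, and by at most the weighted query weights there. [cite: Ambainis2000, Thm. 6 (proof)] -/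
theorem rinner_sub_oracle_le (x y : Fin N → Bool) (a b : Fin N × Bool × W → ℂ)
    (p : Fin N → ℝ) (hp : ∀ i, 0 < p i) :
    rinner a b - rinner (queryOracle x *ᵥ a) (queryOracle y *ᵥ b) ≤
      ∑ i, if x i ≠ y i then p i * fiberWeight a i + fiberWeight b i / p i else 0 := by
  rw [rinner_eq_sum_fib, rinner_oracle_eq_sum_fib, ← Finset.sum_sub_distrib]
  refine Finset.sum_le_sum fun i _ => ?_
  split_ifs with h
  · have h1 := abs_fib_le a b i false false (hp i)
    have h2 := abs_fib_le a b i (x i) (y i) (hp i)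
    have := abs_sub (fib a b i false false) (fib a b i (x i) (y i))
    linarith [le_abs_self (fib a b i false false - fib a b i (x i) (y i))]
  · push Not at h
    rw [h, fib_eq_of_eq a b i (y i), sub_self]

end Oracle

/-! ### The progress function of a relation -/

section Progress

variable {W : Type*} [Fintype W]

/-- A finite relation on inputs. [folklore] -/
abbrev Rel (N : ℕ) : Type := Finset ((Fin N → Bool) × (Fin N → Bool))

/-- `W(Ψ) = ∑_{(x,y) ∈ R} Re ⟨ψ_x|ψ_y⟩`. [cite: Ambainis2000, Thm. 6 (proof)] -/
def prog (R : Rel N) (Ψ : (Fin N → Bool) → Fin N × Bool × W → ℂ) : ℝ :=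
  ∑ e ∈ R, rinner (Ψ e.1) (Ψ e.2)

/-- `ℓ_{x,i}`: partners of `x` (as a left end) differing from `x` at `i`. [cite: Ambainis2000, Thm. 6 (proof)] -/
def l1 (R : Rel N) (x : Fin N → Bool) (i : Fin N) : ℕ := #(R.filter fun e => e.1 = x ∧ e.1 i ≠ e.2 i)

/-- `ℓ_{y,i}`: partners of `y` (as a right end) differing from `y` at `i`. [cite: Ambainis2000, Thm. 6 (proof)] -/
def l2 (R : Rel N) (y : Fin N → Bool) (i : Fin N) : ℕ := #(R.filter fun e => e.2 = y ∧ e.1 i ≠ e.2 i)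

/-- Initially all states are equal: `W = |R| ‖v‖²`. [cite: Ambainis2000, Thm. 6 (proof)] -/
theorem prog_const (R : Rel N) (v : Fin N × Bool × W → ℂ) :
    prog R (fun _ => v) = #R * nsq v := by
  unfold prog
  rw [Finset.sum_const, nsmul_eq_mul, rinner_self]

/-- `ℓ_{x,i} ≥ 1` at a position where a related pair differs. [folklore] -/
theorem one_le_l1 {R : Rel N} {e : (Fin N → Bool) × (Fin N → Bool)} (he : e ∈ R) {i : Fin N}
    (hi : e.1 i ≠ e.2 i) : 1 ≤ l1 R e.1 i := by
  unfold l1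
  rw [Nat.one_le_iff_ne_zero, ← Nat.pos_iff_ne_zero, Finset.card_pos]
  exact ⟨e, Finset.mem_filter.2 ⟨he, rfl, hi⟩⟩

/-- `ℓ_{y,i} ≥ 1` at a position where a related pair differs. [folklore] -/
theorem one_le_l2 {R : Rel N} {e : (Fin N → Bool) × (Fin N → Bool)} (he : e ∈ R) {i : Fin N}
    (hi : e.1 i ≠ e.2 i) : 1 ≤ l2 R e.2 i := by
  unfold l2
  rw [Nat.one_le_iff_ne_zero, ← Nat.pos_iff_ne_zero, Finset.card_pos]
  exact ⟨e, Finset.mem_filter.2 ⟨he, rfl, hi⟩⟩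

/-- Regrouping a double sum over `R` by left ends: for `g x i` depending on the left end only,
`∑_{e ∈ R} ∑_{i : e.1 i ≠ e.2 i} g e.1 i = ∑_{x ∈ R.image fst} ∑_i l1 R x i · g x i`. [cite: Ambainis2000, Thm. 6 (proof)] -/
theorem sum_sum_ite_fst (R : Rel N) (g : (Fin N → Bool) → Fin N → ℝ) :
    ∑ e ∈ R, ∑ i, (if e.1 i ≠ e.2 i then g e.1 i else 0) =
      ∑ x ∈ R.image Prod.fst, ∑ i, (l1 R x i : ℝ) * g x i := by
  classical
  rw [← Finset.sum_fiberwise_of_maps_to (s := R) (t := R.image Prod.fst) (g := Prod.fst)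
    (fun e he => Finset.mem_image_of_mem _ he)]
  refine Finset.sum_congr rfl fun x _ => ?_
  rw [Finset.sum_comm]
  refine Finset.sum_congr rfl fun i _ => ?_
  rw [Finset.sum_ite, Finset.sum_const_zero, add_zero]
  have : ∀ e ∈ (R.filter fun e => e.1 = x).filter (fun e => e.1 i ≠ e.2 i), g e.1 i = g x i := by
    intro e he
    rw [Finset.mem_filter, Finset.mem_filter] at he
    rw [he.1.2]
  rw [Finset.sum_congr rfl this, Finset.sum_const, nsmul_eq_mul]
  unfold l1
  congr 2
  rw [Finset.filter_filter]

/-- The same by right ends. [cite: Ambainis2000, Thm. 6 (proof)] -/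
theorem sum_sum_ite_snd (R : Rel N) (g : (Fin N → Bool) → Fin N → ℝ) :
    ∑ e ∈ R, ∑ i, (if e.1 i ≠ e.2 i then g e.2 i else 0) =
      ∑ y ∈ R.image Prod.snd, ∑ i, (l2 R y i : ℝ) * g y i := by
  classical
  rw [← Finset.sum_fiberwise_of_maps_to (s := R) (t := R.image Prod.snd) (g := Prod.snd)
    (fun e he => Finset.mem_image_of_mem _ he)]
  refine Finset.sum_congr rfl fun y _ => ?_
  rw [Finset.sum_comm]
  refine Finset.sum_congr rfl fun i _ => ?_
  rw [Finset.sum_ite, Finset.sum_const_zero, add_zero]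
  have : ∀ e ∈ (R.filter fun e => e.2 = y).filter (fun e => e.1 i ≠ e.2 i), g e.2 i = g y i := by
    intro e he
    rw [Finset.mem_filter, Finset.mem_filter] at he
    rw [he.1.2]
  rw [Finset.sum_congr rfl this, Finset.sum_const, nsmul_eq_mul]
  unfold l2
  congr 2
  rw [Finset.filter_filter]

variable [DecidableEq W]

/-- **One query costs at most `√ℓ (λ |X| + |Y|/λ)`**. [cite: Ambainis2000, Thm. 6 (proof)] -/
theorem prog_sub_prog_step_le (R : Rel N) {ℓ lam : ℝ} (hℓ : 0 < ℓ) (hlam : 0 < lam)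
    (hR : ∀ e ∈ R, ∀ i, e.1 i ≠ e.2 i → (l1 R e.1 i : ℝ) * l2 R e.2 i ≤ ℓ)
    {U : Matrix (Fin N × Bool × W) (Fin N × Bool × W) ℂ}
    (hU : U ∈ Matrix.unitaryGroup (Fin N × Bool × W) ℂ)
    (Ψ : (Fin N → Bool) → Fin N × Bool × W → ℂ) (hΨ : ∀ x, nsq (Ψ x) = 1) :
    prog R Ψ - prog R (fun x => U *ᵥ (queryOracle x *ᵥ Ψ x)) ≤
      Real.sqrt ℓ * (lam * #(R.image Prod.fst) + #(R.image Prod.snd) / lam) := by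
  have hsℓ : 0 < Real.sqrt ℓ := Real.sqrt_pos.2 hℓ
  unfold prog
  simp only [rinner_mulVec_of_mem_unitaryGroup hU]
  rw [← Finset.sum_sub_distrib]
  -- weights `p e i = λ √ℓ / max 1 (l1 e.1 i)`
  set p : ((Fin N → Bool) × (Fin N → Bool)) → Fin N → ℝ :=
    fun e i => lam * Real.sqrt ℓ / max 1 (l1 R e.1 i : ℝ) with hp
  have hppos : ∀ e i, 0 < p e i := fun e i => by
    rw [hp]
    exact div_pos (mul_pos hlam hsℓ) (lt_of_lt_of_le zero_lt_one (le_max_left _ _))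
  have hstep : ∀ e ∈ R, rinner (Ψ e.1) (Ψ e.2) -
      rinner (queryOracle e.1 *ᵥ Ψ e.1) (queryOracle e.2 *ᵥ Ψ e.2) ≤
      ∑ i, (if e.1 i ≠ e.2 i then p e i * fiberWeight (Ψ e.1) i + fiberWeight (Ψ e.2) i / p e i
        else 0) :=
    fun e _ => rinner_sub_oracle_le e.1 e.2 (Ψ e.1) (Ψ e.2) (p e) (hppos e)
  refine (Finset.sum_le_sum hstep).trans ?_
  -- split the bound into the two weighted sums
  have hsplit : ∀ e ∈ R, (∑ i, (if e.1 i ≠ e.2 i then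
      p e i * fiberWeight (Ψ e.1) i + fiberWeight (Ψ e.2) i / p e i else 0)) ≤
      (∑ i, (if e.1 i ≠ e.2 i then (lam * Real.sqrt ℓ / (l1 R e.1 i : ℝ)) * fiberWeight (Ψ e.1) i
        else 0)) +
      ∑ i, (if e.1 i ≠ e.2 i then (Real.sqrt ℓ / (lam * (l2 R e.2 i : ℝ))) * fiberWeight (Ψ e.2) i
        else 0) := by
    intro e he
    rw [← Finset.sum_add_distrib]
    refine Finset.sum_le_sum fun i _ => ?_
    split_ifs with hi
    · have hl1 : (1 : ℝ) ≤ l1 R e.1 i := by exact_mod_cast one_le_l1 he hi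
      have hl2 : (1 : ℝ) ≤ l2 R e.2 i := by exact_mod_cast one_le_l2 he hi
      have hpe : p e i = lam * Real.sqrt ℓ / (l1 R e.1 i : ℝ) := by
        rw [hp]
        simp only
        rw [max_eq_right hl1]
      rw [hpe]
      have hfw1 := fiberWeight_nonneg (Ψ e.1) i
      have hfw2 := fiberWeight_nonneg (Ψ e.2) i
      -- second term: fw₂ / p = fw₂ · l1 / (λ √ℓ) ≤ fw₂ · (ℓ / l2) / (λ √ℓ) = fw₂ · √ℓ / (λ l2)
      have hprod := hR e he i hi
      have hkey : fiberWeight (Ψ e.2) i / (lam * Real.sqrt ℓ / (l1 R e.1 i : ℝ)) ≤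
          Real.sqrt ℓ / (lam * (l2 R e.2 i : ℝ)) * fiberWeight (Ψ e.2) i := by
        rw [div_div_eq_mul_div]
        rw [div_le_iff₀ (mul_pos hlam hsℓ)]
        -- fw₂ * l1 ≤ (√ℓ/(λ l2)) fw₂ (λ √ℓ) = fw₂ ℓ / l2
        have hl2pos : (0 : ℝ) < l2 R e.2 i := by linarith
        have e1 : Real.sqrt ℓ / (lam * (l2 R e.2 i : ℝ)) * fiberWeight (Ψ e.2) i * (lam * Real.sqrt ℓ)
            = fiberWeight (Ψ e.2) i * (ℓ / l2 R e.2 i) := by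
          field_simp
          rw [Real.sq_sqrt hℓ.le]
          ring
        rw [e1]
        have hl1le : (l1 R e.1 i : ℝ) ≤ ℓ / l2 R e.2 i := by
          rw [le_div_iff₀ hl2pos]; exact hprod
        exact mul_le_mul_of_nonneg_left hl1le hfw2
      linarith
    · simp
  refine (Finset.sum_le_sum hsplit).trans ?_
  rw [Finset.sum_add_distrib,
    sum_sum_ite_fst R (fun x i => (lam * Real.sqrt ℓ / (l1 R x i : ℝ)) * fiberWeight (Ψ x) i),
    sum_sum_ite_snd R (fun y i => (Real.sqrt ℓ / (lam * (l2 R y i : ℝ))) * fiberWeight (Ψ y) i)]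
  -- each regrouped sum is at most (λ√ℓ) · |X| resp. (√ℓ/λ) · |Y|
  have hX : ∑ x ∈ R.image Prod.fst, ∑ i, (l1 R x i : ℝ) *
      ((lam * Real.sqrt ℓ / (l1 R x i : ℝ)) * fiberWeight (Ψ x) i) ≤
      ∑ x ∈ R.image Prod.fst, lam * Real.sqrt ℓ := by
    refine Finset.sum_le_sum fun x _ => ?_
    calc ∑ i, (l1 R x i : ℝ) * ((lam * Real.sqrt ℓ / (l1 R x i : ℝ)) * fiberWeight (Ψ x) i)
        ≤ ∑ i, lam * Real.sqrt ℓ * fiberWeight (Ψ x) i := by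
          refine Finset.sum_le_sum fun i _ => ?_
          have hfw := fiberWeight_nonneg (Ψ x) i
          rcases Nat.eq_zero_or_pos (l1 R x i) with h0 | hpos
          · rw [h0]; simp; positivity
          · have : (l1 R x i : ℝ) * ((lam * Real.sqrt ℓ / (l1 R x i : ℝ)) * fiberWeight (Ψ x) i) =
                lam * Real.sqrt ℓ * fiberWeight (Ψ x) i := by
              have : (l1 R x i : ℝ) ≠ 0 := by exact_mod_cast hpos.ne'
              field_simp
            rw [this]
      _ = lam * Real.sqrt ℓ * nsq (Ψ x) := by rw [← Finset.mul_sum, sum_fiberWeight]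
      _ = lam * Real.sqrt ℓ := by rw [hΨ x, mul_one]
  have hY : ∑ y ∈ R.image Prod.snd, ∑ i, (l2 R y i : ℝ) *
      ((Real.sqrt ℓ / (lam * (l2 R y i : ℝ))) * fiberWeight (Ψ y) i) ≤
      ∑ y ∈ R.image Prod.snd, Real.sqrt ℓ / lam := by
    refine Finset.sum_le_sum fun y _ => ?_
    calc ∑ i, (l2 R y i : ℝ) * ((Real.sqrt ℓ / (lam * (l2 R y i : ℝ))) * fiberWeight (Ψ y) i)
        ≤ ∑ i, Real.sqrt ℓ / lam * fiberWeight (Ψ y) i := by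
          refine Finset.sum_le_sum fun i _ => ?_
          have hfw := fiberWeight_nonneg (Ψ y) i
          rcases Nat.eq_zero_or_pos (l2 R y i) with h0 | hpos
          · rw [h0]; simp; positivity
          · have : (l2 R y i : ℝ) * ((Real.sqrt ℓ / (lam * (l2 R y i : ℝ))) * fiberWeight (Ψ y) i) =
                Real.sqrt ℓ / lam * fiberWeight (Ψ y) i := by
              have : (l2 R y i : ℝ) ≠ 0 := by exact_mod_cast hpos.ne'
              field_simp
            rw [this]
      _ = Real.sqrt ℓ / lam * nsq (Ψ y) := by rw [← Finset.mul_sum, sum_fiberWeight]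
      _ = Real.sqrt ℓ / lam := by rw [hΨ y, mul_one]
  refine (add_le_add hX hY).trans ?_
  rw [Finset.sum_const, Finset.sum_const, nsmul_eq_mul, nsmul_eq_mul]
  have : (#(R.image Prod.fst) : ℝ) * (lam * Real.sqrt ℓ) + #(R.image Prod.snd) * (Real.sqrt ℓ / lam) =
      Real.sqrt ℓ * (lam * #(R.image Prod.fst) + #(R.image Prod.snd) / lam) := by ring
  rw [this]

omit [DecidableEq W] in
/-- **The final weight is small**: `W^T ≤ (1 - 1/72) |R|`. [cite: Ambainis2000, Thm. 6 (proof)] -/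
theorem prog_final_le (R : Rel N) {D : Set (Fin N → Bool)} {f : (Fin N → Bool) → Bool}
    (hD : ∀ e ∈ R, e.1 ∈ D ∧ e.2 ∈ D) (hf : ∀ e ∈ R, f e.1 ≠ f e.2)
    (acc : Finset (Fin N × Bool × W))
    (Ψ : (Fin N → Bool) → Fin N × Bool × W → ℂ) (hΨ : ∀ x, nsq (Ψ x) = 1)
    (h1 : ∀ x ∈ D, f x = true → 2 / 3 ≤ ∑ s ∈ acc, ‖Ψ x s‖ ^ 2)
    (h0 : ∀ x ∈ D, f x = false → ∑ s ∈ acc, ‖Ψ x s‖ ^ 2 ≤ 1 / 3) :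
    prog R Ψ ≤ (1 - 1 / 72) * #R := by
  unfold prog
  have : ∀ e ∈ R, rinner (Ψ e.1) (Ψ e.2) ≤ 1 - 1 / 72 := by
    intro e he
    refine rinner_le_of_gap acc (hΨ _) (hΨ _) ?_
    obtain ⟨hx, hy⟩ := hD e he
    cases hfx : f e.1
    · have hfy : f e.2 = true := by
        cases hfy : f e.2
        · exact absurd (hfx.trans hfy.symm) (hf e he)
        · rfl
      have := h0 _ hx hfx; have := h1 _ hy hfy
      rw [abs_sub_comm, abs_of_nonneg (by linarith)]
      linarith
    · have hfy : f e.2 = false := by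
        cases hfy : f e.2
        · rfl
        · exact absurd (hfx.trans hfy.symm) (hf e he)
      have := h1 _ hx hfx; have := h0 _ hy hfy
      rw [abs_of_nonneg (by linarith)]
      linarith
  calc ∑ e ∈ R, rinner (Ψ e.1) (Ψ e.2) ≤ ∑ e ∈ R, (1 - 1 / 72 : ℝ) := Finset.sum_le_sum this
    _ = (1 - 1 / 72) * #R := by rw [Finset.sum_const, nsmul_eq_mul, mul_comm]

end Progress

end Summit.QuantumAdvantage.QuantumAdvantage.Theorems.WbwVerifiableLineNoSpeedup.Negative.WeightedAdversary
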